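import Summits.HodgeConjecture.HodgeCM.Automorphic.SignRecipe_1

/-! PORT of `HodgeCM/Automorphic/SignRecipe.lean` (HodgeCMPerL run 82) — part 2: continuation of `Summits.HodgeConjecture.HodgeCM.Automorphic.SignRecipe_1` (split at a top-level declaration boundary by port_pkg.py; scope re-opened below; declarations unchanged). -/

-- port_pkg: scope re-opened for this part (file-level context, then the namespace/section stack open at the cut)
noncomputable section
open NumberField NumberField.ComplexEmbedding
open scoped ComplexConjugate
namespace HodgeCM
namespace SignRecipe
open Literature.AlgebraicGeometry.ShimuraVarieties (conjRingHomK embedding_conjRingHomK)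
/-! ## 4. The two DESIGN inputs as theorems, in the shape of `ThetaModel.Design_*` -/

/-- `Design_kappaConj`, unfolded, for the recipe `κ^{(φ^h)}`. -/
theorem design_kappaConj (h : Bool) : ∀ (K L : CMField) (j : K →+* L) (ι₁ τ : L →+* ℂ),
    kappa h K L j ι₁ (conjugate τ) = conjugate (kappa h K L j ι₁ τ) :=
  fun _ _ j ι₁ τ => kappa_conjugate h j ι₁ τ

/-- `Design_frameSignConj`, unfolded, for the frame sign `s`. -/
theorem design_frameSignConj : ∀ (L : CMField) (ι₁ τ : L →+* ℂ),
    frameSign L ι₁ (conjugate τ) = !(frameSign L ι₁ τ) :=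
  fun L ι₁ τ => frameSign_conjugate L ι₁ τ

end SignRecipe

/-! ## 5. Theta models: the design inputs discharged, the eight remaining inputs -/

namespace Universe

namespace ThetaModel

variable {U : Universe} (T : U.ThetaModel)

/-- A theta model whose `κ` IS PerL's recipe satisfies `Design_kappaConj` — a THEOREM, no longer an input. -/
theorem design_kappaConj_of_eq (h : Bool) (hk : T.kappa = SignRecipe.kappa h) : T.Design_kappaConj := by
  intro K L j ι₁ τ
  rw [hk]
  exact SignRecipe.kappa_conjugate h j ι₁ τ

/-- A theta model whose frame sign IS PerL's satisfies `Design_frameSignConj` — a THEOREM. -/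
theorem design_frameSignConj_of_eq (hf : T.frameSign = SignRecipe.frameSign) : T.Design_frameSignConj := by
  intro L ι₁ τ
  rw [hf]
  exact SignRecipe.frameSign_conjugate L ι₁ τ

/-- **The eight NON-DESIGN inputs of a theta model** = `ThetaModel.Inputs` minus `kappaConj`, `frameSignConj`:
the two PRINT facts `embCover`, `innerEmb` and the six PerL OPEN inputs (LEMMAS.md nodes N12, N33, N19w, N19g,
N31, N29).  Field names and statements are those of `ThetaModel.Inputs`. -/
structure NonDesignInputs : Prop where
  embCover : T.Fact_embCover
  innerEmb : T.Fact_innerEmb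
  thetaSub : T.Open_thetaSub
  thetaWedge : T.Open_thetaWedge
  thetaGen12 : T.Open_thetaGen12
  thetaReal34 : T.Open_thetaReal34
  chars : T.Open_chars
  occ : T.Open_occ

/-- The full input record from the eight non-design inputs and the two design theorems. -/
theorem NonDesignInputs.toInputs {T : U.ThetaModel} (A : T.NonDesignInputs) (hκ : T.Design_kappaConj)
    (hs : T.Design_frameSignConj) : T.Inputs :=
  ⟨A.embCover, A.innerEmb, hκ, hs, A.thetaSub, A.thetaWedge, A.thetaGen12, A.thetaReal34, A.chars, A.occ⟩

/-- (Ported verbatim from the HodgeCMPerL package; no docstring in the source.) -/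
theorem Inputs.toNonDesign {T : U.ThetaModel} (A : T.Inputs) : T.NonDesignInputs :=
  ⟨A.embCover, A.innerEmb, A.thetaSub, A.thetaWedge, A.thetaGen12, A.thetaReal34, A.chars, A.occ⟩

/-- **For a theta model carrying PerL's sign recipe, the ten inputs ARE the eight non-design inputs.** -/
theorem inputs_iff_of_signRecipe (h : Bool) (hk : T.kappa = SignRecipe.kappa h)
    (hf : T.frameSign = SignRecipe.frameSign) : T.Inputs ↔ T.NonDesignInputs :=
  ⟨Inputs.toNonDesign, fun A => A.toInputs (T.design_kappaConj_of_eq h hk) (T.design_frameSignConj_of_eq hf)⟩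

end ThetaModel

end Universe

end HodgeCM

end
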